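import Summits.NavierStokesRegularity.NavierStokesRegularity.Theorems.ExtremiserTransienceRegularisedNearPlateauStabilitySparseNearPlateauStability
import Summits.NavierStokesRegularity.NavierStokesRegularity.Theorems.ExtremiserTransienceSparseSliceTransfer
import HarnessLib

/-!
# Route `ExtremiserTransience`, crux `NearExtremalTransiencePerFlow` (stmt-NavierStokesRegularity-26567),
# LINE g8-α «sparse bang-bang»: S-B BY NAME, and the crux FROM THE SINGLE OPEN HEART S-E

`--supports stmt-NavierStokesRegularity-26567` (helper). Author: prover seat `ns-net-p2` (g2).

* `sparseNearPlateauStability` — stub S-B of `Cruxes/NearExtremalTransiencePerFlow/Lines/sparse_bangbang.lean` BY NAME over the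
  texts of record (`…Theorems.NearExtremalTransiencePerFlow.SparseBangBang.SparseNearPlateauStability`, file
  `ExtremiserTransienceSparseBangBangDefs`), proved by the unfolded theorem `BangBang.sparseNearPlateauStability`
  (`…RegularisedNearPlateauStabilitySparseNearPlateauStability`, definitional match).
* `nearExtremalTransiencePerFlow_of_sparseEfficientTimes` — **the line's composition with both provable stubs discharged**:
  S-B (this seat) and S-T (`sparseSliceTransfer`, seat ns-net-p1) are theorems, so the crux `NearExtremalTransiencePerFlow`
  (26567, BY NAME) follows from the ONE remaining open statement S-E `SparseEfficientTimes` («a violator flow has sparse,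
  two-sided-locked, near-efficient late times») via the landed `plateauSliceRigidity`.
HONEST FRAMING: a conditional reduction of an OPEN crux to an OPEN statement (S-E, the crowd wall on the flow side); nothing is
proved about Navier–Stokes regularity; 26567, 28317 and the summit remain OPEN; no summit is proved by a line. [folklore]
-/

noncomputable section

open Summit.NavierStokesRegularity.NavierStokesRegularity.Theses.ExtremiserTransience
open Summit.NavierStokesRegularity.NavierStokesRegularity.Theorems.DepletionLadder.KStar

namespace Summit.NavierStokesRegularity.NavierStokesRegularity.Theorems

-- the problem directory repeats the summit name (`NavierStokesRegularity/NavierStokesRegularity`)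
set_option linter.dupNamespace false

namespace NearExtremalTransiencePerFlow.SparseBangBang

/-- **S-B `SparseNearPlateauStability` (stub `stub_sparseNearPlateauStability` of LINE g8-α, also of LINE g8-β), PROVED** by
name over the texts of record. [folklore] -/
theorem sparseNearPlateauStability : SparseNearPlateauStability := BangBang.sparseNearPlateauStability

/-- **The crux from the open heart alone: `SparseEfficientTimes → NearExtremalTransiencePerFlow`** (26567 BY NAME).
Composition of LINE g8-α with S-B and S-T discharged: a violator flow with sparse efficient times yields (S-T) the weak
one-slice plateau object, excluded by `plateauSliceRigidity`. [folklore] -/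
theorem nearExtremalTransiencePerFlow_of_sparseEfficientTimes (hE : SparseEfficientTimes) :
    Summit.NavierStokesRegularity.NavierStokesRegularity.Theses.ExtremiserTransience.NearExtremalTransiencePerFlow := by
  intro C ν T hC hν hT0 u p hsol hLH hdec hrate hne
  by_contra hno
  exact plateauSliceRigidity
    (sparseSliceTransfer sparseNearPlateauStability hE C ν T u p ⟨hC, hν, hT0, hsol, hLH, hdec, hrate, hne, hno⟩)

end NearExtremalTransiencePerFlow.SparseBangBang

end Summit.NavierStokesRegularity.NavierStokesRegularity.Theorems

end
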